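import Literature.NumberTheory.IwasawaTheory.FukudaCountingLemmas
import HarnessLib

/-!
# Fukuda's Theorem 1 (1) at finite level — brick (D): the `p`-Hilbert class field of a subfield sits inside the `p`-Hilbert class field
# of the top field (Washington §13.3: `L_n ⊆ L`, i.e. `X ↠ X_n`; Lang Ch. 3 §4, Lemma to Thm. 4.3: `H_M · F ⊆ H_F`)

Topic `NumberTheory/IwasawaTheory` (namespace = path). THEOREM-ONLY file (no definition, no named fact, no `sorry`), written by the
prover seat `bsd-potss-k8t-c4` g19 (cell `bsd-potss`; Fukuda road of stmt-BirchSwinnertonDyer-19982; closes nothing). Brick (D) of the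
finite-level proof of `fukuda1994_thm1_classNumberPExp_const_of_succ_eq` (bricks (N), (G), (R), (C) landed; plan memo
`run/shared/lean/pub/bsd-potss/k8t-c4/g19/SCOPE-fukuda1994-thm1-holds-k8t-c4-g19.md`). It is the «≥» half of the counting identity
`p^{e(M)} = [Gal(H_p/M) : Gal(H_p/M)'·⟨inertia⟩]` for a subfield `M ⊆ F` over which `F` is Galois and `H_p ⊆ H_F` any subextension
of the Hilbert class field of `F`, Galois over `M`, containing every subextension of `p`-power degree over `F` (the `p`-Hilbert class
field): `p^{ord_p h(M)}` DIVIDES the index of `N = G'·⟨I(𝔔) : 𝔔⟩` in `G = Gal(H_p/M)`. PROOF: brick (C) puts a copy `P ⊆ \bar F` of the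
`p`-Hilbert class field of `M` (abelian, unramified, degree `p^{ord_p h(M)}`); the compositum `L = P·F ⊆ \bar F` is abelian over `F`
(compositum of abelian extensions of `M`, then tower) and unramified over `F` at all places (base change, `UnramifiedAbelianBaseChange`
§2), so `L ⊆ H_F` (maximality, `hilbertClassField.le_hilbertClassField`) and, having `p`-power degree over `F`, `L ⊆ H_p`; thus `P`
is (isomorphic to) a subextension `P'` of `H_p/M`, abelian and unramified, and `N ≤ Gal(H_p/P')` (commutators die in the abelian
`Gal(P'/M)`; inertia groups die by `isUnramifiedAt_under_iff_inertia_le'`), whose index is `[P' : M] = p^{ord_p h(M)}`. The «≤» half is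
brick (C) §2.

References: [Washington1997] §13.3 (Lemma 13.15 ff.: `L_n` = maximal unramified abelian `p`-extension of `K_n`, `L_n ⊆ L`);
[Lang1990] Ch. 3 §4, Lemma to Thm. 4.3; [Cox2013] §8.A Thm. 8.10, §5.C Cor. 5.24.
-/

noncomputable section

open scoped NumberField
open NumberField IsDedekindDomain Field IntermediateField

namespace Literature.NumberTheory.NumberFields

open scoped Pointwise

set_option maxHeartbeats 1600000 in
set_option synthInstance.maxHeartbeats 200000 in
/-- **The `p`-Hilbert class field of `M` inside the `p`-Hilbert class field of `F ⊇ M`: `p^{ord_p h(M)} ∣ [G : G'·⟨inertia⟩]`.** Let `F/M`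
be a finite Galois extension of number fields, `H = H_F` the Hilbert class field of `F`, and `Hq ⊆ H` an intermediate field over `F`,
Galois over `M`, containing every intermediate field of `H/F` of `p`-power degree over `F`. Then for `G = Gal(Hq/M)` and
`N = G' ⊔ ⨆_𝔔 I(𝔔)` (commutators and all inertia groups), `p^{ord_p h(M)} ∣ [G : N]`.
[cite: Washington1997, §13.3 Lemma 13.15 (set-up: `L_n ⊆ L`)] [cite: Lang1990, Ch. 3 §4, Lemma to Thm. 4.3] [cite: Cox2013, §8.A Thm. 8.10] -/
theorem pow_padicValNat_classNumber_dvd_index_commutator_sup_inertia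
    (M F : Type) [Field M] [NumberField M] [Field F] [NumberField F] [Algebra M F] [IsGalois M F] (p : ℕ) [Fact p.Prime]
    (Hq : IntermediateField F (hilbertClassField F))
    (hmax : ∀ L : IntermediateField F (hilbertClassField F), (∃ k, Module.finrank F L = p ^ k) → L ≤ Hq)
    [IsGalois M Hq] :
    p ^ padicValNat p (classNumber M) ∣
      (⁅(⊤ : Subgroup (Hq ≃ₐ[M] Hq)), ⊤⁆ ⊔ ⨆ (Q : MaximalSpectrum (𝓞 Hq)), Q.asIdeal.inertia (Hq ≃ₐ[M] Hq)).index := by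
  classical
  let Ω := AlgebraicClosure F
  haveI : FiniteDimensional M F := inferInstance
  haveI : Algebra.IsAlgebraic M Ω := Algebra.IsAlgebraic.trans M F Ω
  haveI : FiniteDimensional M (hilbertClassField F) := Module.Finite.trans F (hilbertClassField F)
  haveI : FiniteDimensional M Hq := Module.Finite.trans F Hq
  haveI : NumberField Hq := NumberField.of_module_finite F Hq
  -- the `p`-Hilbert class field of `M`, realised in `Ω = \bar F`
  obtain ⟨P, hPfd, hPab, hPinf, hPunr, hPdeg⟩ := exists_intermediateField_pHilbert M p Ω
  haveI := hPfd
  haveI := hPab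
  haveI := hPinf
  haveI : NumberField P := NumberField.of_module_finite M P
  -- the copy `F₀` of `F` in `Ω` over `M`, and the compositum `L₀ = P F₀`
  set F₀ : IntermediateField M Ω := (IsScalarTower.toAlgHom M F Ω).fieldRange with hF₀
  let eF : F ≃ₐ[M] F₀ := AlgEquiv.ofInjectiveField (IsScalarTower.toAlgHom M F Ω)
  haveI : FiniteDimensional M F₀ := LinearEquiv.finiteDimensional eF.toLinearEquiv
  haveI : IsGalois M F₀ := IsGalois.of_algEquiv eF
  set L₀ : IntermediateField M Ω := P ⊔ F₀ with hL₀
  haveI : FiniteDimensional M L₀ := IntermediateField.finiteDimensional_sup P F₀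
  -- `L₀` as an intermediate field OVER `F`
  have hFmem : ∀ x : F, algebraMap F Ω x ∈ L₀ := fun x =>
    (le_sup_right : F₀ ≤ L₀) ⟨x, rfl⟩
  let L : IntermediateField F Ω := L₀.toSubfield.toIntermediateField hFmem
  have hLres : L.restrictScalars M = L₀ := by ext x; exact Iff.rfl
  haveI : FiniteDimensional M L := by
    have : FiniteDimensional M (L.restrictScalars M) := by rw [hLres]; infer_instance
    exact this
  haveI : FiniteDimensional F L := Module.Finite.of_restrictScalars_finite M F L
  haveI : NumberField L := NumberField.of_module_finite F L
  -- base change inside `T = L`: `K₁ = P`, `L₁ = F`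
  let val : L →ₐ[M] Ω := (L.val).restrictScalars M
  have hval : ∀ x : L, val x = (x : Ω) := fun _ => rfl
  have hrange : val.fieldRange = L₀ := by
    ext x
    constructor
    · rintro ⟨y, rfl⟩; exact y.2
    · intro hx; exact ⟨⟨x, hx⟩, rfl⟩
  let K₁ : IntermediateField M L := P.comap val
  let L₁ : IntermediateField M L := (⊥ : IntermediateField F L).restrictScalars M
  have hK₁map : K₁.map val = P := IntermediateField.map_comap_eq_self (by rw [hrange]; exact le_sup_left)
  have hL₁map : L₁.map val = F₀ := by
    ext x
    constructor
    · rintro ⟨y, hy, rfl⟩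
      obtain ⟨z, hz⟩ := (IntermediateField.mem_bot.mp hy)
      refine ⟨z, ?_⟩
      change algebraMap F Ω z = ((y : L) : Ω)
      rw [← hz]; rfl
    · rintro ⟨z, rfl⟩
      refine ⟨⟨algebraMap F Ω z, hFmem z⟩, ?_, rfl⟩
      change (⟨algebraMap F Ω z, hFmem z⟩ : L) ∈ (⊥ : IntermediateField F L)
      exact IntermediateField.mem_bot.mpr ⟨z, rfl⟩
  have hsup : K₁ ⊔ L₁ = ⊤ := by
    apply IntermediateField.map_injective val
    rw [IntermediateField.map_sup, hK₁map, hL₁map, ← hL₀, ← hrange]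
    ext x
    constructor
    · rintro ⟨y, rfl⟩; exact ⟨y, trivial, rfl⟩
    · rintro ⟨y, -, rfl⟩; exact ⟨y, rfl⟩
  -- `K₁ ≅ P` over `M`
  let fK : K₁ →ₐ[M] P := (val.comp K₁.val).codRestrict P.toSubalgebra (fun y => y.2)
  haveI : FiniteDimensional M K₁ :=
    FiniteDimensional.of_injective fK.toLinearMap (fun a b h => by
      apply Subtype.ext; apply Subtype.ext
      have := congrArg (fun z : P => (z : Ω)) h
      exact this)
  haveI : IsAbelianGalois M K₁ := IsAbelianGalois.of_algHom fK
  haveI : NumberField K₁ := NumberField.of_module_finite M K₁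
  haveI : NumberField L₁ := NumberField.of_module_finite M L₁
  haveI : IsUnramifiedAtInfinitePlaces M K₁ := isUnramifiedAtInfinitePlaces_of_algHom fK
  have hunrK₁ : ∀ v : HeightOneSpectrum (𝓞 M), Algebra.IsUnramifiedIn (𝓞 K₁) v.asIdeal :=
    forall_isUnramifiedIn_of_algHom fK hPunr
  haveI hLab : IsAbelianGalois L₁ L := isAbelianGalois_right_of_sup_eq_top K₁ L₁ hsup
  haveI hLinf : IsUnramifiedAtInfinitePlaces L₁ L := isUnramifiedAtInfinitePlaces_right_of_sup_eq_top K₁ L₁ hsup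
  have hLunr : ∀ w : HeightOneSpectrum (𝓞 L₁), Algebra.IsUnramifiedIn (𝓞 L) w.asIdeal :=
    isUnramifiedIn_right_of_sup_eq_top K₁ L₁ hunrK₁ hsup
  have hfKbij : Function.Bijective fK := by
    refine ⟨fun a b h => ?_, fun z => ?_⟩
    · apply Subtype.ext; apply Subtype.ext
      exact congrArg (fun z : P => (z : Ω)) h
    · have hzL : (z : Ω) ∈ L₀ := (le_sup_left : P ≤ L₀) z.2
      refine ⟨⟨⟨z, hzL⟩, ?_⟩, Subtype.ext rfl⟩
      change val ⟨z, hzL⟩ ∈ P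
      exact z.2
  have hK₁deg : Module.finrank M K₁ = Module.finrank M P :=
    (LinearEquiv.ofBijective fK.toLinearMap hfKbij).finrank_eq
  have hLdeg : Module.finrank L₁ L ∣ p ^ padicValNat p (classNumber M) := by
    rw [← hPdeg, ← hK₁deg]
    exact finrank_right_dvd_of_sup_eq_top K₁ L₁ hsup
  -- from `L₁ = F` (inside `L`) to `F`
  have hbot : ∀ y : L₁, ∃ z : F, algebraMap F L z = (y : L) := fun y => IntermediateField.mem_bot.mp y.2
  -- every `F`-automorphism of `L` is an `L₁`-automorphism
  have lift : ∀ σ : L ≃ₐ[F] L, ∃ σ' : L ≃ₐ[L₁] L, ∀ x, σ' x = σ x := by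
    intro σ
    refine ⟨{ σ with commutes' := ?_ }, fun _ => rfl⟩
    intro y
    obtain ⟨z, hz⟩ := hbot y
    change σ (y : L) = (y : L)
    rw [← hz, AlgEquiv.commutes]
  have hFdeg : Module.finrank F L = Module.finrank L₁ L := (IntermediateField.finrank_bot' (F := F) (E := L)).symm
  obtain ⟨k, -, hk⟩ := (Nat.dvd_prime_pow (Fact.out : p.Prime)).mp hLdeg
  -- `L/F` is abelian
  haveI : Normal M L := by
    have : Normal M (L.restrictScalars M) := by rw [hLres]; infer_instance
    exact this
  haveI : IsGalois M L := IsGalois.mk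
  haveI : IsGalois F L := IsGalois.tower_top_of_isGalois M F L
  haveI : IsAbelianGalois F L := by
    refine { is_comm := ⟨fun σ τ => ?_⟩ }
    obtain ⟨σ', hσ'⟩ := lift σ
    obtain ⟨τ', hτ'⟩ := lift τ
    have hc := hLab.is_comm.comm σ' τ'
    ext x
    have := congrArg (fun f : L ≃ₐ[L₁] L => f x) hc
    simp only [AlgEquiv.mul_apply] at this ⊢
    rw [← hσ', ← hτ', this, hτ', hσ']
  -- `L/F` is unramified at the infinite places
  haveI : IsUnramifiedAtInfinitePlaces F (⊥ : IntermediateField F L) :=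
    IsUnramifiedAtInfinitePlaces_of_odd_finrank (by rw [IntermediateField.finrank_bot]; exact odd_one)
  haveI : IsUnramifiedAtInfinitePlaces (⊥ : IntermediateField F L) L := hLinf
  haveI : IsUnramifiedAtInfinitePlaces F L := IsUnramifiedAtInfinitePlaces.trans F (⊥ : IntermediateField F L) L
  -- `L/F` is unramified at every finite prime: its inertia groups over `F` are inertia groups over `L₁`, which are trivial
  have hunrL : ∀ v : HeightOneSpectrum (𝓞 F), Algebra.IsUnramifiedIn (𝓞 L) v.asIdeal := by
    intro v Q hQ hQv
    haveI := hQ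
    have hQ0 : Q ≠ ⊥ := by
      intro h0
      apply v.ne_bot
      rw [hQv.over, h0, Ideal.under_def, Ideal.comap_bot_of_injective _
        (FaithfulSMul.algebraMap_injective (𝓞 F) (𝓞 L))]
    haveI : Q.IsMaximal := hQ.isMaximal hQ0
    -- the inertia group over `L₁` is trivial
    have hw0 : Q.under (𝓞 L₁) ≠ ⊥ := mt Ideal.eq_bot_of_comap_eq_bot hQ0
    haveI : (Q.under (𝓞 L₁)).IsMaximal := Ideal.IsMaximal.under (𝓞 L₁) Q
    let w : HeightOneSpectrum (𝓞 L₁) := ⟨Q.under (𝓞 L₁), inferInstance, hw0⟩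
    haveI : Algebra.IsUnramifiedAt (𝓞 L₁) Q := hLunr w Q hQ ⟨rfl⟩
    have hI₁ : Q.inertia (L ≃ₐ[L₁] L) = ⊥ := by
      apply Subgroup.eq_bot_of_card_eq
      rw [card_inertia_eq_ramificationIdx L (L ≃ₐ[L₁] L) L₁ Q]
      exact Ideal.ramificationIdx_eq_one _ _
    -- hence so is the one over `F`
    have hI : Q.inertia (L ≃ₐ[F] L) = ⊥ := by
      rw [eq_bot_iff]
      intro σ hσ
      obtain ⟨σ', hσ'⟩ := lift σ
      have hσ'I : σ' ∈ Q.inertia (L ≃ₐ[L₁] L) := fun y => by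
        have h1 := hσ y
        change σ' • y - y ∈ Q
        have h2 : σ' • y = σ • y := by
          apply Subtype.ext
          change σ' (y : L) = σ (y : L)
          exact hσ' y
        rw [h2]; exact h1
      rw [hI₁, Subgroup.mem_bot] at hσ'I
      rw [Subgroup.mem_bot]
      ext x
      rw [← hσ' x, hσ'I, AlgEquiv.one_apply, AlgEquiv.one_apply]
    have he : Q.ramificationIdx (𝓞 F) = 1 := by
      rw [← card_inertia_eq_ramificationIdx L (L ≃ₐ[F] L) F Q, hI, Subgroup.card_bot]
    exact (Ideal.ramificationIdx_eq_one_iff).mp he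
  -- maximality of the Hilbert class field: `L ≤ H_F`, and `L` has `p`-power degree over `F`, so `L ≤ Hq`
  have hLH : L ≤ hilbertClassField F := hilbertClassField.le_hilbertClassField F L hunrL
  set LE : IntermediateField F (hilbertClassField F) := IntermediateField.restrict hLH with hLE
  have hLEdeg : Module.finrank F LE = p ^ k := by
    rw [hLE, ← (IntermediateField.restrict_algEquiv hLH).toLinearEquiv.finrank_eq, hFdeg, hk]
  have hLEq : LE ≤ Hq := hmax LE ⟨k, hLEdeg⟩
  -- `P` as an intermediate field `Pq` of `Hq/M`
  let valq : Hq →ₐ[M] Ω := ((hilbertClassField F).val.comp Hq.val).restrictScalars M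
  have hvalq : ∀ x : Hq, valq x = ((x : hilbertClassField F) : Ω) := fun _ => rfl
  let Pq : IntermediateField M Hq := P.comap valq
  let fq : Pq →ₐ[M] P := (valq.comp Pq.val).codRestrict P.toSubalgebra (fun y => y.2)
  have hfqbij : Function.Bijective fq := by
    refine ⟨fun a b h => ?_, fun z => ?_⟩
    · apply Subtype.ext; apply Subtype.ext; apply Subtype.ext
      exact congrArg (fun z : P => (z : Ω)) h
    · have hzL : (z : Ω) ∈ L := (le_sup_left : P ≤ L₀) z.2
      have hzE : (⟨(z : Ω), hLH hzL⟩ : hilbertClassField F) ∈ LE := by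
        rw [hLE, IntermediateField.mem_restrict]; exact hzL
      refine ⟨⟨⟨⟨z, hLH hzL⟩, hLEq hzE⟩, ?_⟩, Subtype.ext rfl⟩
      change valq ⟨⟨z, hLH hzL⟩, hLEq hzE⟩ ∈ P
      exact z.2
  haveI : FiniteDimensional M Pq := FiniteDimensional.of_injective fq.toLinearMap hfqbij.1
  have hPqdeg : Module.finrank M Pq = p ^ padicValNat p (classNumber M) := by
    rw [← hPdeg]; exact (LinearEquiv.ofBijective fq.toLinearMap hfqbij).finrank_eq
  haveI : IsAbelianGalois M Pq := IsAbelianGalois.of_algHom fq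
  haveI : NumberField Pq := NumberField.of_module_finite M Pq
  have hunrPq : ∀ v : HeightOneSpectrum (𝓞 M), Algebra.IsUnramifiedIn (𝓞 Pq) v.asIdeal :=
    forall_isUnramifiedIn_of_algHom fq hPunr
  -- the subgroup `S = Gal(Hq/Pq)` contains `N`
  set S : Subgroup (Hq ≃ₐ[M] Hq) := Pq.fixingSubgroup with hS
  have hcommS : ⁅(⊤ : Subgroup (Hq ≃ₐ[M] Hq)), ⊤⁆ ≤ S := by
    rw [hS, ← IntermediateField.restrictNormalHom_ker Pq, ← commutator_def]
    letI : CommGroup (Pq ≃ₐ[M] Pq) :=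
      { (inferInstance : Group (Pq ≃ₐ[M] Pq)) with
        mul_comm := fun a b => (IsMulCommutative.is_comm (M := Pq ≃ₐ[M] Pq)).comm a b }
    exact Abelianization.commutator_subset_ker _
  have hIS : ∀ Q : MaximalSpectrum (𝓞 Hq), Q.asIdeal.inertia (Hq ≃ₐ[M] Hq) ≤ S := by
    intro Q
    haveI := Q.isMaximal
    have hQ0 : Q.asIdeal ≠ ⊥ := Ring.ne_bot_of_isMaximal_of_not_isField Q.isMaximal (RingOfIntegers.not_isField Hq)
    haveI : (Q.asIdeal.under (𝓞 Pq)).IsMaximal := Ideal.IsMaximal.under (𝓞 Pq) Q.asIdeal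
    haveI : (Q.asIdeal.under (𝓞 M)).IsMaximal := Ideal.IsMaximal.under (𝓞 M) Q.asIdeal
    have hv0 : Q.asIdeal.under (𝓞 M) ≠ ⊥ := mt Ideal.eq_bot_of_comap_eq_bot hQ0
    let v : HeightOneSpectrum (𝓞 M) := ⟨Q.asIdeal.under (𝓞 M), inferInstance, hv0⟩
    haveI : Algebra.IsUnramifiedAt (𝓞 M) (Q.asIdeal.under (𝓞 Pq)) :=
      hunrPq v (Q.asIdeal.under (𝓞 Pq)) inferInstance ⟨(Ideal.under_under (B := 𝓞 Pq) Q.asIdeal).symm⟩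
    rw [hS, ← isUnramifiedAt_under_iff_inertia_le' Pq Q.asIdeal]
    infer_instance
  have hNS : (⁅(⊤ : Subgroup (Hq ≃ₐ[M] Hq)), ⊤⁆ ⊔ ⨆ (Q : MaximalSpectrum (𝓞 Hq)), Q.asIdeal.inertia (Hq ≃ₐ[M] Hq)) ≤ S :=
    sup_le hcommS (iSup_le hIS)
  -- `[G : S] = [Pq : M] = p^{ord_p h(M)}`
  have hSindex : S.index = p ^ padicValNat p (classNumber M) := by
    rw [← hPqdeg]
    have h1 : S.index * Nat.card S = Nat.card (Hq ≃ₐ[M] Hq) := S.index_mul_card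
    rw [hS, IsGalois.card_fixingSubgroup_eq_finrank Pq, IsGalois.card_aut_eq_finrank, ← Module.finrank_mul_finrank M Pq Hq] at h1
    exact Nat.eq_of_mul_eq_mul_right Module.finrank_pos h1
  rw [← hSindex]
  exact Subgroup.index_dvd_of_le hNS

end Literature.NumberTheory.NumberFields

end
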